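import Summits.CriticalPhenomena.PercolationContinuityZ3.Theorems.PercNearOneGluingNoHeavyQuantLongTailTripleHubAlg
import HarnessLib

/-!
# QUANT lane R8, T-DEC: THE LONG-TAIL TRIPLE HUB, ROUTE FILE — the route of the low atom `3lo` of the width-3 hub `S(γ₁) ∗ S(γ₂) ∗ S(γ₃)` of shape
# `{lo, lo+K; γ}`, `2lo ≤ K ≤ 3lo`, at ONE outer gate: the atom `3lo+K` while its credit capacity lasts, `3lo+2K` afterwards (census-1 gen 32)

builds on p205010 (kernel theorem, internal audit signed; external expert review pending)

Support file (`--supports stmt-CriticalPhenomena-4575`), QUANT lane seat prim-quant-census-1 (gen 32); memo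
`run/shared/lean/prim/quant/prim-quant-census-1/g32/TWOLO-G32.md` §6.  Theorems only, standard axioms, no sorries.  The SDEC theorem is
`…QuantLongTailTripleHub` (`sdec_sHub_three_long`); the closed forms are `…QuantLongTailTripleHubAlg`.  Same architecture as the pair hub
(`…QuantLongTailPairHubRoute`): for `K ≤ 3lo` the only positive low of the width-3 hub is `3lo` (`T > 6lo`), the atom `3lo+K ≤ 6lo` is NEAR and
compatible below `6lo+K`, the atom `3lo+2K` is always compatible (`T₀ < 3lo+3K ≤ 6lo+2K`) and near above `3lo+2K`; the top is never needed.
* **`tripleHubLong_costTop`** — the second route's torque cost in the floor regime `θ = y` when `3lo+2K` is still far (`T < 3lo+2K`):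
  `0 ≤ (T₀ − xT)(u₀(T−3lo) + u₁(T−3lo−K)) − (3lo+2K−T)·xT·u₀`, a concave quadratic in `T` on `[τ, min(T₀, 3lo+2K)]`, `τ = 6lo + K·u₁/(u₀+u₁)`:
  at `T₀` the torque identity `u₀(T₀−3lo)+u₁(T₀−3lo−K) = u₂(3lo+2K−T₀)+u₃(3lo+3K−T₀)` and the floor capacity `x(u₀+u₂) ≤ u₂` (`ltTriple_capTop`); at
  `3lo+2K` the cost vanishes; at `τ`: `u₀(τ−3lo)+u₁(τ−3lo−K) = 3lo(u₀+u₁)`, `(3lo+2K−τ)(u₀+u₁) = (2K−3lo)u₀+(K−3lo)u₁` and `ltTriple_cost0`.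
* **`tripleHubLong_route`** — THE CERTIFICATE per outer gate (`ν` the gated law, `T = aT₀ > 6lo`, `y = ax`): a target `t ∈ {3lo+K, 3lo+2K}` for the low
  `3lo` with `T < 3lo + t`, capacity `freeRate(y,T,3lo,t)·ν(3lo) ≤ ν(t)` and torque cost within the budget.

HONEST STATUS.  Route bookkeeping; `SiblingStep`, `GluedDominatedMass`, `SDECConvClosed`, `FarTreeRow` OPEN; RATE class (log\*) / honest sentence of
`run/shared/lean/prim/quant/README.md` unchanged.  [this work].  Nothing here is cited as a published result.  The gluing rows served
[cite: KozmaNitzan2024, Conjecture 3 (p. 15)]; product measure [cite: Grimmett1999, §1.3 p. 10].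
-/

noncomputable section

open scoped BigOperators

namespace Summit.CriticalPhenomena.PercolationContinuityZ3.Theorems
namespace Quant
namespace LawDec

open Finset

/-! ### The second route's cost -/

/-- **the second route's torque cost in the floor regime** (`θ = y`, `T < 3lo+2K`): with `u₀, u₁, u₂, u₃` the Poisson-binomial masses of the three
gates and `T₀ = 3lo + K(g₁+g₂+g₃)`, exhausted middle-low credit `K·u₁ < (T−6lo)(u₀+u₁)` and `T ≤ T₀` give
`0 ≤ (T₀ − xT)(u₀(T−3lo) + u₁(T−3lo−K)) − (3lo+2K−T)·xT·u₀`. [this work] -/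
theorem tripleHubLong_costTop (lo K g₁ g₂ g₃ x T : ℝ) (hlo0 : 0 < lo) (hK2R : 2 * lo ≤ K) (hK3R : K ≤ 3 * lo) (hg : lo ≤ K * g₁)
    (h12 : g₁ ≤ g₂) (h13 : g₁ ≤ g₃) (h21 : g₂ < 1) (h31 : g₃ < 1) (hx0 : 0 < x) (hxg : x * (lo + K) ≤ lo + K * g₁)
    (hbr' : K * (g₁ * (1 - g₂) * (1 - g₃) + g₂ * (1 - g₁) * (1 - g₃) + g₃ * (1 - g₁) * (1 - g₂))
      < (T - 6 * lo) * ((1 - g₁) * (1 - g₂) * (1 - g₃) + (g₁ * (1 - g₂) * (1 - g₃) + g₂ * (1 - g₁) * (1 - g₃) + g₃ * (1 - g₁) * (1 - g₂))))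
    (hTle : T ≤ 3 * lo + K * (g₁ + g₂ + g₃)) (hT2 : T ≤ 3 * lo + 2 * K) :
    0 ≤ (3 * lo + K * (g₁ + g₂ + g₃) - x * T)
        * ((1 - g₁) * (1 - g₂) * (1 - g₃) * (T - 3 * lo) + (g₁ * (1 - g₂) * (1 - g₃) + g₂ * (1 - g₁) * (1 - g₃) + g₃ * (1 - g₁) * (1 - g₂)) * (T - (3 * lo + K)))
      - (3 * lo + 2 * K - T) * (x * T) * ((1 - g₁) * (1 - g₂) * (1 - g₃)) := by
  have hK0 : (0 : ℝ) < K := by linarith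
  have hg10 : 0 < g₁ := by
    by_contra hc; push Not at hc
    have : K * g₁ ≤ 0 := mul_nonpos_of_nonneg_of_nonpos hK0.le hc
    linarith
  have hg11 : g₁ < 1 := lt_of_le_of_lt h12 h21
  have hg2 : 0 ≤ g₂ := le_trans hg10.le h12
  have hg3 : 0 ≤ g₃ := le_trans hg10.le h13
  set u0 : ℝ := (1 - g₁) * (1 - g₂) * (1 - g₃) with hu0
  set u1 : ℝ := g₁ * (1 - g₂) * (1 - g₃) + g₂ * (1 - g₁) * (1 - g₃) + g₃ * (1 - g₁) * (1 - g₂) with hu1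
  set u2 : ℝ := g₁ * g₂ * (1 - g₃) + g₁ * g₃ * (1 - g₂) + g₂ * g₃ * (1 - g₁) with hu2
  set u3 : ℝ := g₁ * g₂ * g₃ with hu3
  have hu0p : 0 < u0 := mul_pos (mul_pos (by linarith) (by linarith)) (by linarith)
  have hu1n : 0 ≤ u1 := by rw [hu1]; positivity
  have hu2n : 0 ≤ u2 := by
    rw [hu2]
    have : 0 ≤ 1 - g₁ := by linarith
    have : 0 ≤ 1 - g₂ := by linarith
    have : 0 ≤ 1 - g₃ := by linarith
    positivity
  have hu3n : 0 ≤ u3 := by rw [hu3]; positivity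
  set W : ℝ := u0 + u1 with hW
  have hWp : 0 < W := by linarith
  have hWne : W ≠ 0 := hWp.ne'
  set T₀ : ℝ := 3 * lo + K * (g₁ + g₂ + g₃) with hT₀
  have hT0p : 0 < T₀ := by
    have := mul_pos hK0 (by linarith : 0 < g₁ + g₂ + g₃); rw [hT₀]; linarith
  have hT0top : T₀ < 3 * lo + 3 * K := by
    have := mul_lt_mul_of_pos_left (by linarith : g₁ + g₂ + g₃ < 3) hK0; rw [hT₀]; linarith
  have hB0 : (0 : ℝ) < lo + K := by linarith
  set D : ℝ := T - 6 * lo with hD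
  have hDle : D ≤ K * (g₁ + g₂ + g₃) - 3 * lo := by rw [hD]; rw [hT₀] at hTle; linarith
  -- the middle-low credit is exhausted at `a = 1`
  have htopAlg : K * u1 < (K * (g₁ + g₂ + g₃) - 3 * lo) * W := by
    have : D * W ≤ (K * (g₁ + g₂ + g₃) - 3 * lo) * W := mul_le_mul_of_nonneg_right hDle hWp.le
    linarith
  have hx1 : x < 1 := by
    have : lo + K * g₁ < lo + K := by have := mul_lt_mul_of_pos_left hg11 hK0; linarith
    by_contra hc; push Not at hc
    have : 1 * (lo + K) ≤ x * (lo + K) := mul_le_mul_of_nonneg_right hc hB0.le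
    linarith
  have hxu2 : x * (u0 + u2) ≤ u2 := by
    have h1 := ltTriple_capTop lo K g₁ g₂ g₃ hlo0 hK2R hK3R hg h12 h13 h21.le h31.le
      (by have h := htopAlg.le; rw [hW, hu0, hu1] at h; exact h)
    rw [← hu0, ← hu2] at h1
    have h2 : x * (lo + K) * (u0 + u2) ≤ (lo + K * g₁) * (u0 + u2) :=
      mul_le_mul_of_nonneg_right hxg (add_nonneg hu0p.le hu2n)
    have h3 : (lo + K) * (x * (u0 + u2)) ≤ (lo + K) * u2 := by linarith
    exact le_of_mul_le_mul_left h3 hB0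
  -- the quadratic `Ψ(S) = (T₀ − xS)(u0(S−3lo) + u1(S−3lo−K)) − (3lo+2K−S)·xS·u0`
  set α : ℝ := -(T₀ * (3 * lo * u0 + (3 * lo + K) * u1)) with hα
  set β : ℝ := T₀ * (u0 + u1) + x * (3 * lo * u0 + (3 * lo + K) * u1) - (3 * lo + 2 * K) * x * u0 with hβ
  set κ : ℝ := x * u1 with hκ
  have eΨ : ∀ S : ℝ, (T₀ - x * S) * (u0 * (S - 3 * lo) + u1 * (S - (3 * lo + K))) - (3 * lo + 2 * K - S) * (x * S) * u0
      = α + β * S - κ * S ^ 2 := by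
    intro S; rw [hα, hβ, hκ]; ring
  -- the right endpoint `S₁ = min(T₀, 3lo+2K)`
  set S₁ : ℝ := min T₀ (3 * lo + 2 * K) with hS₁
  have hTS₁ : T ≤ S₁ := le_min hTle hT2
  have hΨS₁ : 0 ≤ (T₀ - x * S₁) * (u0 * (S₁ - 3 * lo) + u1 * (S₁ - (3 * lo + K))) - (3 * lo + 2 * K - S₁) * (x * S₁) * u0 := by
    rcases le_total T₀ (3 * lo + 2 * K) with hle | hle
    · have eS : S₁ = T₀ := min_eq_left hle
      rw [eS]
      have torque : u0 * (T₀ - 3 * lo) + u1 * (T₀ - (3 * lo + K)) = u2 * (3 * lo + 2 * K - T₀) + u3 * (3 * lo + 3 * K - T₀) := by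
        rw [hu0, hu1, hu2, hu3, hT₀]; ring
      rw [torque]
      have e : (T₀ - x * T₀) * (u2 * (3 * lo + 2 * K - T₀) + u3 * (3 * lo + 3 * K - T₀)) - (3 * lo + 2 * K - T₀) * (x * T₀) * u0
          = T₀ * (3 * lo + 2 * K - T₀) * (u2 - x * (u0 + u2)) + T₀ * (1 - x) * u3 * (3 * lo + 3 * K - T₀) := by ring
      rw [e]
      have t1 : 0 ≤ T₀ * (3 * lo + 2 * K - T₀) * (u2 - x * (u0 + u2)) := mul_nonneg (mul_nonneg hT0p.le (by linarith)) (by linarith)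
      have t2 : 0 ≤ T₀ * (1 - x) * u3 * (3 * lo + 3 * K - T₀) :=
        mul_nonneg (mul_nonneg (mul_nonneg hT0p.le (by linarith)) hu3n) (by linarith)
      linarith
    · have eS : S₁ = 3 * lo + 2 * K := min_eq_right hle
      rw [eS]
      have e : (T₀ - x * (3 * lo + 2 * K)) * (u0 * (3 * lo + 2 * K - 3 * lo) + u1 * (3 * lo + 2 * K - (3 * lo + K)))
          - (3 * lo + 2 * K - (3 * lo + 2 * K)) * (x * (3 * lo + 2 * K)) * u0 = (T₀ - x * (3 * lo + 2 * K)) * (2 * K * u0 + K * u1) := by ring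
      rw [e]
      have h1 : x * (3 * lo + 2 * K) ≤ T₀ := by
        have h1a : x * (3 * lo + 2 * K) ≤ x * T₀ := mul_le_mul_of_nonneg_left hle hx0.le
        have h1b : x * T₀ ≤ 1 * T₀ := mul_le_mul_of_nonneg_right hx1.le hT0p.le
        linarith
      exact mul_nonneg (by linarith) (by positivity)
  -- the switching point `τ = 6lo + K·u1/W`
  set τ : ℝ := 6 * lo + K * u1 / W with hτ
  have hτW : τ * W = 6 * lo * W + K * u1 := by rw [hτ, add_mul, div_mul_cancel₀ _ hWne]
  have hτT : τ ≤ T := by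
    have hDW : D * W = T * W - 6 * lo * W := by rw [hD]; ring
    have : τ * W ≤ T * W := by rw [hτW]; linarith
    exact le_of_mul_le_mul_right this hWp
  have hτT0 : τ ≤ T₀ := le_trans hτT hTle
  have hC0 := ltTriple_cost0 lo K g₁ g₂ g₃ x hlo0 hK2R hK3R hg h12 h13 h21.le h31.le hx0.le hxg
  rw [← hu0, ← hu1, ← hW] at hC0
  have hΨτ : 0 ≤ (T₀ - x * τ) * (u0 * (τ - 3 * lo) + u1 * (τ - (3 * lo + K))) - (3 * lo + 2 * K - τ) * (x * τ) * u0 := by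
    have e1 : u0 * (τ - 3 * lo) + u1 * (τ - (3 * lo + K)) = 3 * lo * W := by
      have : (u0 * (τ - 3 * lo) + u1 * (τ - (3 * lo + K))) * W = (3 * lo * W) * W := by
        have e : (u0 * (τ - 3 * lo) + u1 * (τ - (3 * lo + K))) * W
            = (τ * W) * (u0 + u1) - (3 * lo * u0 + (3 * lo + K) * u1) * W := by ring
        rw [e, hτW, hW]; ring
      exact mul_right_cancel₀ hWne this
    have e2 : (3 * lo + 2 * K - τ) * W = (2 * K - 3 * lo) * u0 + (K - 3 * lo) * u1 := by
      have e : (3 * lo + 2 * K - τ) * W = (3 * lo + 2 * K) * W - τ * W := by ring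
      rw [e, hτW, hW]; ring
    rw [e1]
    have key : 0 ≤ ((T₀ - x * τ) * (3 * lo * W) - (3 * lo + 2 * K - τ) * (x * τ) * u0) * W := by
      have e : ((T₀ - x * τ) * (3 * lo * W) - (3 * lo + 2 * K - τ) * (x * τ) * u0) * W
          = (T₀ - x * τ) * (3 * lo * W ^ 2) - (x * τ) * u0 * ((3 * lo + 2 * K - τ) * W) := by ring
      rw [e, e2]
      set br : ℝ := (2 * K - 3 * lo) * u0 + (K - 3 * lo) * u1 with hbr
      have m1 : T₀ - x * T₀ ≤ T₀ - x * τ := by have := mul_le_mul_of_nonneg_left hτT0 hx0.le; linarith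
      have m5 : (T₀ - x * T₀) * (3 * lo * W ^ 2) ≤ (T₀ - x * τ) * (3 * lo * W ^ 2) := mul_le_mul_of_nonneg_right m1 (by positivity)
      have hτ0 : 0 ≤ τ := by
        rw [hτ]; exact add_nonneg (by positivity) (div_nonneg (mul_nonneg hK0.le hu1n) hWp.le)
      rcases le_total 0 br with hbr0 | hbr0
      · -- bracket nonnegative: compare with the value at `T₀` and use `ltTriple_cost0`
        have m2 : (x * τ) * u0 * br ≤ (x * T₀) * u0 * br :=
          mul_le_mul_of_nonneg_right (mul_le_mul_of_nonneg_right (mul_le_mul_of_nonneg_left hτT0 hx0.le) hu0p.le) hbr0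
        have m3 : (T₀ - x * T₀) * (3 * lo * W ^ 2) - (x * T₀) * u0 * br = T₀ * (3 * lo * (1 - x) * W ^ 2 - x * u0 * br) := by ring
        have m4 : 0 ≤ T₀ * (3 * lo * (1 - x) * W ^ 2 - x * u0 * br) := mul_nonneg hT0p.le (by rw [hbr]; linarith)
        linarith
      · -- bracket nonpositive: both terms are nonnegative
        have m6 : x * T₀ ≤ 1 * T₀ := mul_le_mul_of_nonneg_right hx1.le hT0p.le
        have t1 : 0 ≤ (T₀ - x * τ) * (3 * lo * W ^ 2) := mul_nonneg (by linarith) (by positivity)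
        have t2 : (x * τ) * u0 * br ≤ 0 := mul_nonpos_of_nonneg_of_nonpos (mul_nonneg (mul_nonneg hx0.le hτ0) hu0p.le) hbr0
        linarith
    exact nonneg_of_mul_nonneg_left key hWp
  -- concavity between `τ` and `S₁`
  have h1 : 0 ≤ α + β * τ - κ * τ ^ 2 := by rw [← eΨ τ]; exact hΨτ
  have h2 : 0 ≤ α + β * S₁ - κ * S₁ ^ 2 := by rw [← eΨ S₁]; exact hΨS₁
  have hquad := quad_concave_between (by rw [hκ]; exact mul_nonneg hx0.le hu1n) h1 h2 hτT hTS₁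
  have hΨT : 0 ≤ (T₀ - x * T) * (u0 * (T - 3 * lo) + u1 * (T - (3 * lo + K))) - (3 * lo + 2 * K - T) * (x * T) * u0 := by
    rw [eΨ T]; exact hquad
  exact hΨT

/-! ### The route of the long-tail triple hub -/

/-- **the route of the long-tail triple hub at one outer gate** (`ν` the gated law with masses `a·u₀, a·u₁, a·u₂` at `3lo, 3lo+K, 3lo+2K`, `y = ax`
the gated floor, `T = a(3lo + K(g₁+g₂+g₃)) > 6lo` the gated mean, `g₁` the least gate): a target for the low atom `3lo` — the atom `3lo+K` while
`(T−6lo)(ν(3lo)+ν(3lo+K)) ≤ K·ν(3lo+K)`, the atom `3lo+2K` afterwards — with its compatibility, capacity and torque-cost facts. [this work] -/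
theorem tripleHubLong_route (lo K : ℕ) (hloK : lo < K) (hK2 : 2 * lo ≤ K) (hK3 : K ≤ 3 * lo) (ν : ℕ → ℝ) (y T a g₁ g₂ g₃ x : ℝ)
    (g0 : ∀ h, 0 ≤ ν h) (h12 : g₁ ≤ g₂) (h13 : g₁ ≤ g₃) (hg : (lo : ℝ) ≤ K * g₁) (h21 : g₂ < 1) (h31 : g₃ < 1) (hx0 : 0 < x)
    (hxg : x * ((lo : ℝ) + K) ≤ lo + K * g₁) (ha0 : 0 < a) (ha1 : a ≤ 1) (hy : y = a * x)
    (hT : T = a * (3 * (lo : ℝ) + K * (g₁ + g₂ + g₃))) (hT6 : 6 * (lo : ℝ) < T)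
    (v0 : ν (3 * lo) = a * ((1 - g₁) * (1 - g₂) * (1 - g₃)))
    (v1 : ν (3 * lo + K) = a * (g₁ * (1 - g₂) * (1 - g₃) + g₂ * (1 - g₁) * (1 - g₃) + g₃ * (1 - g₁) * (1 - g₂)))
    (v2 : ν (3 * lo + 2 * K) = a * (g₁ * g₂ * (1 - g₃) + g₁ * g₃ * (1 - g₂) + g₂ * g₃ * (1 - g₁))) :
    ∃ t : ℕ, (t = 3 * lo + K ∨ t = 3 * lo + 2 * K) ∧ (T < ((3 * lo : ℕ) : ℝ) + (t : ℝ)) ∧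
      freeRate y T (3 * lo) t * ν (3 * lo) ≤ ν t ∧
      (if T < (t : ℝ) then ((t : ℝ) - T) * (freeRate y T (3 * lo) t * ν (3 * lo)) else 0)
        ≤ ∑ l ∈ Finset.range (3 * lo + 3 * K + 1), (if (1 ≤ l ∧ (l : ℝ) < T) then ν l * (T - l) else 0) := by
  -- scalars
  have hlo1 : 1 ≤ lo := by omega
  have hloR : (1 : ℝ) ≤ lo := by exact_mod_cast hlo1
  have hlo0 : (0 : ℝ) < lo := by linarith
  have hK2R : 2 * (lo : ℝ) ≤ K := by exact_mod_cast hK2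
  have hK3R : (K : ℝ) ≤ 3 * lo := by exact_mod_cast hK3
  have hK0 : (0 : ℝ) < K := by linarith
  have hg10 : 0 < g₁ := by
    by_contra hc; push Not at hc
    have : (K : ℝ) * g₁ ≤ 0 := mul_nonpos_of_nonneg_of_nonpos hK0.le hc
    linarith
  have hg11 : g₁ < 1 := lt_of_le_of_lt h12 h21
  have hg2 : 0 ≤ g₂ := le_trans hg10.le h12
  have hg3 : 0 ≤ g₃ := le_trans hg10.le h13
  set u0 : ℝ := (1 - g₁) * (1 - g₂) * (1 - g₃) with hu0
  set u1 : ℝ := g₁ * (1 - g₂) * (1 - g₃) + g₂ * (1 - g₁) * (1 - g₃) + g₃ * (1 - g₁) * (1 - g₂) with hu1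
  set u2 : ℝ := g₁ * g₂ * (1 - g₃) + g₁ * g₃ * (1 - g₂) + g₂ * g₃ * (1 - g₁) with hu2
  have hu0p : 0 < u0 := mul_pos (mul_pos (by linarith) (by linarith)) (by linarith)
  have hu1n : 0 ≤ u1 := by rw [hu1]; positivity
  have hu2n : 0 ≤ u2 := by
    rw [hu2]
    have : 0 ≤ 1 - g₁ := by linarith
    have : 0 ≤ 1 - g₂ := by linarith
    have : 0 ≤ 1 - g₃ := by linarith
    positivity
  have hW0 : 0 ≤ u0 + u1 := by linarith
  set W : ℝ := u0 + u1 with hW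
  have hWp : 0 < W := by linarith
  set T₀ : ℝ := 3 * (lo : ℝ) + K * (g₁ + g₂ + g₃) with hT₀
  have hT0p : 0 < T₀ := by
    have := mul_pos hK0 (by linarith : 0 < g₁ + g₂ + g₃); rw [hT₀]; linarith
  have hTle : T ≤ T₀ := by
    have := mul_le_mul_of_nonneg_right ha1 hT0p.le; rw [hT]; linarith
  have hT0top : T₀ < 3 * (lo : ℝ) + 3 * K := by
    have := mul_lt_mul_of_pos_left (by linarith : g₁ + g₂ + g₃ < 3) hK0; rw [hT₀]; linarith
  have hx1 : x < 1 := by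
    have : (lo : ℝ) + K * g₁ < lo + K := by have := mul_lt_mul_of_pos_left hg11 hK0; linarith
    by_contra hc; push Not at hc
    have : 1 * ((lo : ℝ) + K) ≤ x * (lo + K) := mul_le_mul_of_nonneg_right hc (by linarith)
    linarith
  have hyx : y ≤ x := by rw [hy]; have := mul_le_mul_of_nonneg_right ha1 hx0.le; linarith
  have hy0 : 0 < y := by rw [hy]; exact mul_pos ha0 hx0
  have hy1 : y < 1 := lt_of_le_of_lt hyx hx1
  have hB0 : (0 : ℝ) < (lo : ℝ) + K := by linarith
  have hxu1 : x * W ≤ u1 := by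
    have h1 := ltTriple_capMid (lo : ℝ) K g₁ g₂ g₃ hK0.le hg10.le hg h12 h13 h21.le h31.le
    rw [← hu0, ← hu1, ← hW] at h1
    have h2 : x * ((lo : ℝ) + K) * W ≤ ((lo : ℝ) + K * g₁) * W := mul_le_mul_of_nonneg_right hxg hWp.le
    have h3 : ((lo : ℝ) + K) * (x * W) ≤ ((lo : ℝ) + K) * u1 := by linarith
    exact le_of_mul_le_mul_left h3 hB0
  -- the budget terms
  set D : ℝ := T - 6 * (lo : ℝ) with hD
  have hDp : 0 < D := by rw [hD]; linarith
  have hDle : D ≤ K * (g₁ + g₂ + g₃) - 3 * lo := by have h := hTle; rw [hT₀] at h; rw [hD]; linarith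
  set F : ℕ → ℝ := fun l => if (1 ≤ l ∧ (l : ℝ) < T) then ν l * (T - l) else 0 with hF
  clear_value F
  have Fnn : ∀ l ∈ Finset.range (3 * lo + 3 * K + 1), 0 ≤ F l := by
    intro l _; rw [hF]; dsimp only; split_ifs with hc
    · exact mul_nonneg (g0 l) (by linarith [hc.2])
    · exact le_rfl
  have c3lo : ((3 * lo : ℕ) : ℝ) = 3 * (lo : ℝ) := by push_cast; ring
  have cA1 : ((3 * lo + K : ℕ) : ℝ) = 3 * (lo : ℝ) + K := by push_cast; ring
  have hTA1 : 3 * (lo : ℝ) + K < T := by linarith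
  have Flo : F (3 * lo) = ν (3 * lo) * (T - 3 * (lo : ℝ)) := by
    rw [hF]; dsimp only; rw [if_pos ⟨by omega, by rw [c3lo]; linarith⟩, c3lo]
  have Fmid : F (3 * lo + K) = ν (3 * lo + K) * (T - (3 * (lo : ℝ) + K)) := by
    rw [hF]; dsimp only; rw [if_pos ⟨by omega, by rw [cA1]; exact hTA1⟩, cA1]
  have bud2 : ν (3 * lo) * (T - 3 * (lo : ℝ)) + ν (3 * lo + K) * (T - (3 * (lo : ℝ) + K)) ≤ ∑ l ∈ Finset.range (3 * lo + 3 * K + 1), F l := by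
    have hsub : ({3 * lo, 3 * lo + K} : Finset ℕ) ⊆ Finset.range (3 * lo + 3 * K + 1) := by
      intro l hl; simp only [Finset.mem_insert, Finset.mem_singleton] at hl; simp only [Finset.mem_range]; omega
    have hs := Finset.sum_le_sum_of_subset_of_nonneg hsub (fun l hl _ => Fnn l hl)
    have e : ∑ l ∈ ({3 * lo, 3 * lo + K} : Finset ℕ), F l = F (3 * lo) + F (3 * lo + K) := by
      have n1 : 3 * lo ∉ ({3 * lo + K} : Finset ℕ) := by simp only [Finset.mem_singleton]; omega
      rw [Finset.sum_insert n1, Finset.sum_singleton]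
    rw [e, Flo, Fmid] at hs; exact hs
  have bud0 : 0 ≤ ∑ l ∈ Finset.range (3 * lo + 3 * K + 1), F l := Finset.sum_nonneg Fnn
  -- the two regimes
  by_cases hbr : D * (ν (3 * lo) + ν (3 * lo + K)) ≤ K * ν (3 * lo + K)
  · -- regime A: everything to `3lo + K` (near, no cost)
    have hbr' : D * W ≤ K * u1 := by
      rw [v0, v1] at hbr
      have : a * (D * W) ≤ a * (K * u1) := by rw [hW]; linarith
      exact le_of_mul_le_mul_left this ha0
    have hDK : D < K := by
      by_contra hc; push Not at hc
      have h1 : K * W ≤ D * W := mul_le_mul_of_nonneg_right hc hWp.le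
      have e : K * W = K * u0 + K * u1 := by rw [hW]; ring
      have h2 := mul_pos hK0 hu0p
      linarith
    have ed : (((3 * lo + K : ℕ) : ℝ) - ((3 * lo : ℕ) : ℝ)) = K := by push_cast; ring
    have eD : T - 2 * (((3 * lo : ℕ) : ℝ)) = D := by rw [c3lo, hD]; ring
    have eθ : freeRate y T (3 * lo) (3 * lo + K) = max y (D / K) / (1 - max y (D / K)) := by
      unfold freeRate; rw [ed, eD]
    have hρ1 : D / K < 1 := by rw [div_lt_one hK0]; exact hDK
    have hθ1 : max y (D / K) < 1 := max_lt hy1 hρ1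
    have hcap : max y (D / K) * (ν (3 * lo) + ν (3 * lo + K)) ≤ ν (3 * lo + K) := by
      rw [max_mul_of_nonneg _ _ (add_nonneg (g0 _) (g0 _))]
      refine max_le ?_ ?_
      · rw [v0, v1]
        have h1 : y * W ≤ x * W := mul_le_mul_of_nonneg_right hyx hWp.le
        have h2 : a * (y * W) ≤ a * u1 := mul_le_mul_of_nonneg_left (le_trans h1 hxu1) ha0.le
        rw [hW] at h2; linarith
      · rw [div_mul_eq_mul_div, div_le_iff₀ hK0]; rw [hW] at hbr'; linarith
    refine ⟨3 * lo + K, Or.inl rfl, by push_cast; linarith, ?_, ?_⟩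
    · rw [eθ]; exact rate_mul_le_of_theta hθ1 hcap (g0 _)
    · rw [if_neg (by rw [cA1]; linarith)]; exact bud0
  · -- regime B: everything to `3lo + 2K`
    have hbr' : K * u1 < D * W := by
      have hc := lt_of_not_ge hbr
      rw [v0, v1] at hc
      have : a * (K * u1) < a * (D * W) := by rw [hW]; linarith
      exact lt_of_mul_lt_mul_left this ha0.le
    have htopAlg : K * u1 < (K * (g₁ + g₂ + g₃) - 3 * lo) * W := by
      have : D * W ≤ (K * (g₁ + g₂ + g₃) - 3 * lo) * W := mul_le_mul_of_nonneg_right hDle hWp.le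
      linarith
    have ed : (((3 * lo + 2 * K : ℕ) : ℝ) - ((3 * lo : ℕ) : ℝ)) = 2 * K := by push_cast; ring
    have eD : T - 2 * (((3 * lo : ℕ) : ℝ)) = D := by rw [c3lo, hD]; ring
    have eθ : freeRate y T (3 * lo) (3 * lo + 2 * K) = max y (D / (2 * K)) / (1 - max y (D / (2 * K))) := by
      unfold freeRate; rw [ed, eD]
    have hK20 : (0 : ℝ) < 2 * K := by linarith
    have hρ1 : D / (2 * K) < 1 := by rw [div_lt_one hK20]; linarith
    have hθ1 : max y (D / (2 * K)) < 1 := max_lt hy1 hρ1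
    -- capacities
    have hxu2 : x * (u0 + u2) ≤ u2 := by
      have h1 := ltTriple_capTop (lo : ℝ) K g₁ g₂ g₃ hlo0 hK2R hK3R hg h12 h13 h21.le h31.le
        (by have h := htopAlg.le; rw [hW, hu0, hu1] at h; exact h)
      rw [← hu0, ← hu2] at h1
      have h2 : x * ((lo : ℝ) + K) * (u0 + u2) ≤ ((lo : ℝ) + K * g₁) * (u0 + u2) :=
        mul_le_mul_of_nonneg_right hxg (add_nonneg hu0p.le hu2n)
      have h3 : ((lo : ℝ) + K) * (x * (u0 + u2)) ≤ ((lo : ℝ) + K) * u2 := by linarith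
      exact le_of_mul_le_mul_left h3 hB0
    have hcap : max y (D / (2 * K)) * (ν (3 * lo) + ν (3 * lo + 2 * K)) ≤ ν (3 * lo + 2 * K) := by
      rw [max_mul_of_nonneg _ _ (add_nonneg (g0 _) (g0 _))]
      refine max_le ?_ ?_
      · rw [v0, v2]
        have h1 : y * (u0 + u2) ≤ x * (u0 + u2) := mul_le_mul_of_nonneg_right hyx (add_nonneg hu0p.le hu2n)
        have h2 : a * (y * (u0 + u2)) ≤ a * u2 := mul_le_mul_of_nonneg_left (le_trans h1 hxu2) ha0.le
        linarith
      · rw [v0, v2, div_mul_eq_mul_div, div_le_iff₀ hK20]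
        have h1 := ltTriple_capRho (lo : ℝ) K g₁ g₂ g₃ hlo0 hK2R hK3R hg
          (le_trans hg (mul_le_mul_of_nonneg_left h12 hK0.le)) (le_trans hg (mul_le_mul_of_nonneg_left h13 hK0.le)) hg11.le h21.le h31.le
        rw [← hu0, ← hu2] at h1
        have h2 : D * (u0 + u2) ≤ (K * (g₁ + g₂ + g₃) - 3 * lo) * (u0 + u2) := mul_le_mul_of_nonneg_right hDle (add_nonneg hu0p.le hu2n)
        have h3 : a * (D * (u0 + u2)) ≤ a * (2 * K * u2) := mul_le_mul_of_nonneg_left (le_trans h2 h1) ha0.le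
        linarith
    refine ⟨3 * lo + 2 * K, Or.inr rfl, by push_cast; linarith, ?_, ?_⟩
    · rw [eθ]; exact rate_mul_le_of_theta hθ1 hcap (g0 _)
    · split_ifs with hfar
      · -- the second atom is still far: torque cost
        refine le_trans ?_ bud2
        rw [eθ]
        refine cost_le_of_theta hθ1 ?_
        have hT2 : T ≤ 3 * (lo : ℝ) + 2 * K := by
          have : T < ((3 * lo + 2 * K : ℕ) : ℝ) := hfar
          push_cast at this; linarith
        push_cast
        rcases le_total y (D / (2 * K)) with hle | hle
        · rw [max_eq_right hle]
          have hs : D / (2 * K) * ((3 * (lo : ℝ) + 2 * K) - 3 * (lo : ℝ)) ≤ T - 3 * (lo : ℝ) := by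
            have e : (3 * (lo : ℝ) + 2 * K) - 3 * (lo : ℝ) = 2 * K := by ring
            rw [e, div_mul_cancel₀ _ hK20.ne', hD]; linarith
          have c := pieceBlob_costA (lo := 3 * (lo : ℝ)) hs (g0 (3 * lo))
          have hpos : 0 ≤ (1 - D / (2 * K)) * (ν (3 * lo + K) * (T - (3 * (lo : ℝ) + K))) :=
            mul_nonneg (by linarith) (mul_nonneg (g0 _) (by linarith))
          linarith
        · rw [max_eq_left hle, v0, v1]
          have hbrRaw : (K : ℝ) * (g₁ * (1 - g₂) * (1 - g₃) + g₂ * (1 - g₁) * (1 - g₃) + g₃ * (1 - g₁) * (1 - g₂))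
              < (T - 6 * (lo : ℝ)) * ((1 - g₁) * (1 - g₂) * (1 - g₃)
                + (g₁ * (1 - g₂) * (1 - g₃) + g₂ * (1 - g₁) * (1 - g₃) + g₃ * (1 - g₁) * (1 - g₂))) := by
            have h := hbr'; rw [hD, hW, hu0, hu1] at h; exact h
          have hTleRaw : T ≤ 3 * (lo : ℝ) + K * (g₁ + g₂ + g₃) := by have h := hTle; rw [hT₀] at h; exact h
          have hΨT := tripleHubLong_costTop (lo : ℝ) K g₁ g₂ g₃ x T hlo0 hK2R hK3R hg h12 h13 h21 h31 hx0 hxg hbrRaw hTleRaw hT2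
          rw [← hu0, ← hu1, ← hT₀] at hΨT
          have exT : x * T = y * T₀ := by rw [hy, hT]; ring
          set R : ℝ := (1 - y) * (u0 * (T - 3 * lo) + u1 * (T - (3 * lo + K))) - (3 * lo + 2 * K - T) * y * u0 with hR
          have e : (T₀ - x * T) * (u0 * (T - 3 * lo) + u1 * (T - (3 * lo + K))) - (3 * lo + 2 * K - T) * (x * T) * u0 = T₀ * R := by
            rw [hR, exT]; ring
          have hR0 : 0 ≤ T₀ * R := by rw [← e]; exact hΨT
          have h6 : 0 ≤ R := nonneg_of_mul_nonneg_right hR0 hT0p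
          have h7 : 0 ≤ a * R := mul_nonneg ha0.le h6
          rw [hR] at h7
          linarith [h7]
      · exact bud0

end LawDec
end Quant
end Summit.CriticalPhenomena.PercolationContinuityZ3.Theorems
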